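import Summits.AtomisticToContinuum.HydrodynamicLimit.Theorems.ImplosionDichotomyPolynomialCompressionLevel3DefsB
import Summits.AtomisticToContinuum.HydrodynamicLimit.Theorems.ImplosionDichotomyPolynomialCompressionTorusJetCalculus

/-!
# Pointwise size bookkeeping for the integrated level-3 rate (line `log-lipschitz-budget`, stub 4)

Helper file for the crux `ImplosionDichotomy.PolynomialCompression` (stmt-AtomisticToContinuum-12587), stub
`stub_logBudgetShadowing` (level-3 estimate), companion of `…Level3IntegratedRate`: pure pointwise facts. At a point
where the three Friedrichs weights are `≥ M⁻¹`, the unweighted magnitudes of `δV` and of its derivatives are dominated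
by the weighted level densities (`level3Rate_sizes_pt`: `N² ≤ 13122 e₃`, `m₀² ≤ 50 M e₀`, `m₁² ≤ 450 M e₁`,
`q² ≤ 4050 M e₂`, `n² ≤ 36450 M e₃`, third-order unweighted energies `≤ 2 M e₃`); the jets of `δV` are bounded by
`l3m0, l3m1, l3q` (`level3Rate_jets`); the envelope base `1 ≤ R₀ ≤ l3base` (`level3Rate_base`).
-/

noncomputable section

namespace Summit.AtomisticToContinuum.HydrodynamicLimit.Theorems

open Set MeasureTheory
open Literature.MathematicalPhysics.KineticTheory Literature.Analysis.FunctionSpaces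

/-- Reversal of a triple sum over `Fin 3`. [folklore] -/
private theorem l3ir_sum3_rev (g : Fin 3 → Fin 3 → Fin 3 → ℝ) :
    ∑ i, ∑ j, ∑ k, g k j i = ∑ k, ∑ j, ∑ i, g k j i := by
  simp only [Fin.sum_univ_three]
  ring

/-- A nonnegative family is termwise below its triple sum. [folklore] -/
private theorem l3ir_le_sum3 {g : Fin 3 → Fin 3 → Fin 3 → ℝ} (hg : ∀ i j k, 0 ≤ g i j k) (a b c : Fin 3) :
    g a b c ≤ ∑ i, ∑ j, ∑ k, g i j k := by
  calc g a b c ≤ ∑ k, g a b k :=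
        Finset.single_le_sum (f := fun k => g a b k) (fun k _ => hg a b k) (Finset.mem_univ c)
    _ ≤ ∑ j, ∑ k, g a j k :=
        Finset.single_le_sum (f := fun j => ∑ k, g a j k)
          (fun j _ => Finset.sum_nonneg fun k _ => hg a j k) (Finset.mem_univ b)
    _ ≤ ∑ i, ∑ j, ∑ k, g i j k :=
        Finset.single_le_sum (f := fun i => ∑ j, ∑ k, g i j k)
          (fun i _ => Finset.sum_nonneg fun j _ => Finset.sum_nonneg fun k _ => hg i j k) (Finset.mem_univ a)

/-- A nonnegative family is termwise below its double sum. [folklore] -/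
private theorem l3ir_le_sum2 {g : Fin 3 → Fin 3 → ℝ} (hg : ∀ i j, 0 ≤ g i j) (a b : Fin 3) :
    g a b ≤ ∑ i, ∑ j, g i j := by
  calc g a b ≤ ∑ j, g a j :=
        Finset.single_le_sum (f := fun j => g a j) (fun j _ => hg a j) (Finset.mem_univ b)
    _ ≤ ∑ i, ∑ j, g i j :=
        Finset.single_le_sum (f := fun i => ∑ j, g i j)
          (fun i _ => Finset.sum_nonneg fun j _ => hg i j) (Finset.mem_univ a)

/-- Sums over `Fin 3` (simple, double, triple) of terms bounded by `b` are at most `3b, 9b, 27b`. [folklore] -/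
private theorem l3ir_sum_le_card {b : ℝ} :
    (∀ {f : Fin 3 → ℝ}, (∀ i, f i ≤ b) → ∑ i, f i ≤ 3 * b) ∧
    (∀ {f : Fin 3 → Fin 3 → ℝ}, (∀ i j, f i j ≤ b) → ∑ i, ∑ j, f i j ≤ 9 * b) ∧
    (∀ {f : Fin 3 → Fin 3 → Fin 3 → ℝ}, (∀ i j k, f i j k ≤ b) → ∑ i, ∑ j, ∑ k, f i j k ≤ 27 * b) := by
  refine ⟨fun {f} h => ?_, fun {f} h => ?_, fun {f} h => ?_⟩
  · simp only [Fin.sum_univ_three]; linarith [h 0, h 1, h 2]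
  · simp only [Fin.sum_univ_three]
    linarith [h 0 0, h 0 1, h 0 2, h 1 0, h 1 1, h 1 2, h 2 0, h 2 1, h 2 2]
  · have h9 : ∀ i, ∑ j, ∑ k, f i j k ≤ 9 * b := fun i => by
      simp only [Fin.sum_univ_three]
      linarith [h i 0 0, h i 0 1, h i 0 2, h i 1 0, h i 1 1, h i 1 2, h i 2 0, h i 2 1, h i 2 2]
    simp only [Fin.sum_univ_three] at h9 ⊢
    linarith [h9 0, h9 1, h9 2]

/-- If `0 ≤ a` and `a² ≤ B` then `a ≤ √B`; squares of sums of `K` such terms are `≤ K² B`. The form used: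
`0 ≤ s`, `s ≤ K √B` gives `s² ≤ K² B` (`K, B ≥ 0`). [folklore] -/
private theorem l3ir_sq_le_of_le_mul_sqrt {s K B : ℝ} (hs : 0 ≤ s) (_hK : 0 ≤ K) (hB : 0 ≤ B)
    (h : s ≤ K * Real.sqrt B) : s ^ 2 ≤ K ^ 2 * B := by
  calc s ^ 2 ≤ (K * Real.sqrt B) ^ 2 := pow_le_pow_left₀ hs h 2
    _ = K ^ 2 * B := by rw [mul_pow, Real.sq_sqrt hB]

/-- Weight absorption: `t² ≤ M (w t²)`-type facts. If `1 ≤ M w` and `t² ≤ T` with `w T ≤ 2 e` then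
`t² ≤ 2 M e`; stated as: `M⁻¹ ≤ w`, `0 < M` give `t ^ 2 ≤ M * (w * t ^ 2)`. [folklore] -/
private theorem l3ir_absorb {M w t : ℝ} (hM : 0 < M) (hw : M⁻¹ ≤ w) : t ^ 2 ≤ M * (w * t ^ 2) := by
  have h1 : 1 ≤ M * w := by
    have := mul_le_mul_of_nonneg_left hw hM.le
    rwa [mul_inv_cancel₀ hM.ne'] at this
  nlinarith [sq_nonneg t]

/-- One energy block `e = ½(A a² + P |b|² + B c²)` with weights `≥ M⁻¹`: the unweighted squares are `≤ 2M e`,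
`e ≥ 0`, and the weighted magnitude `√A|a| + √P|b| + √B|c|` is `≤ 3√(2e)`. [folklore] -/
private theorem l3ir_term {Mv A P B a nb c : ℝ} (hMv : 0 < Mv) (hA : Mv⁻¹ ≤ A) (hP : Mv⁻¹ ≤ P)
    (hB : Mv⁻¹ ≤ B) (hnb : 0 ≤ nb) :
    a ^ 2 ≤ 2 * Mv * (1 / 2 * (A * a ^ 2 + P * nb ^ 2 + B * c ^ 2)) ∧
    nb ^ 2 ≤ 2 * Mv * (1 / 2 * (A * a ^ 2 + P * nb ^ 2 + B * c ^ 2)) ∧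
    c ^ 2 ≤ 2 * Mv * (1 / 2 * (A * a ^ 2 + P * nb ^ 2 + B * c ^ 2)) ∧
    0 ≤ 1 / 2 * (A * a ^ 2 + P * nb ^ 2 + B * c ^ 2) ∧
    Real.sqrt A * |a| + Real.sqrt P * nb + Real.sqrt B * |c| ≤
      3 * Real.sqrt (2 * (1 / 2 * (A * a ^ 2 + P * nb ^ 2 + B * c ^ 2))) := by
  have hM0 : 0 < Mv⁻¹ := inv_pos.2 hMv
  have hA0 : 0 ≤ A := hM0.le.trans hA
  have hP0 : 0 ≤ P := hM0.le.trans hP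
  have hB0 : 0 ≤ B := hM0.le.trans hB
  have h1 := l3ir_absorb (t := a) hMv hA
  have h2 := l3ir_absorb (t := nb) hMv hP
  have h3 := l3ir_absorb (t := c) hMv hB
  have hAa : 0 ≤ A * a ^ 2 := by positivity
  have hPb : 0 ≤ P * nb ^ 2 := by positivity
  have hBc : 0 ≤ B * c ^ 2 := by positivity
  refine ⟨by nlinarith, by nlinarith, by nlinarith, by positivity, ?_⟩
  have e : 2 * (1 / 2 * (A * a ^ 2 + P * nb ^ 2 + B * c ^ 2)) = A * a ^ 2 + P * nb ^ 2 + B * c ^ 2 := by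
    ring
  rw [e]
  have k1 : Real.sqrt A * |a| ≤ Real.sqrt (A * a ^ 2 + P * nb ^ 2 + B * c ^ 2) := by
    rw [← Real.sqrt_sq_eq_abs, ← Real.sqrt_mul hA0]
    exact Real.sqrt_le_sqrt (by linarith)
  have k2 : Real.sqrt P * nb ≤ Real.sqrt (A * a ^ 2 + P * nb ^ 2 + B * c ^ 2) := by
    calc Real.sqrt P * nb = Real.sqrt P * Real.sqrt (nb ^ 2) := by rw [Real.sqrt_sq hnb]
      _ = Real.sqrt (P * nb ^ 2) := (Real.sqrt_mul hP0 _).symm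
      _ ≤ _ := Real.sqrt_le_sqrt (by linarith)
  have k3 : Real.sqrt B * |c| ≤ Real.sqrt (A * a ^ 2 + P * nb ^ 2 + B * c ^ 2) := by
    rw [← Real.sqrt_sq_eq_abs, ← Real.sqrt_mul hB0]
    exact Real.sqrt_le_sqrt (by linarith)
  linarith

/-- Coordinates of the iterated derivatives of a difference of smooth vector fields. [folklore] -/
private theorem l3ir_coord {U U₁ : T3 → V3} (h : Torus.IsSmooth (fun y => U y - U₁ y)) (c : Fin 3) (x : T3) :
    (∀ a, Torus.partialDeriv a (fun y => U y c - U₁ y c) x = Torus.partialDeriv a (fun y => U y - U₁ y) x c) ∧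
    (∀ a b, Torus.partialDeriv b (Torus.partialDeriv a (fun y => U y c - U₁ y c)) x =
      Torus.partialDeriv b (Torus.partialDeriv a (fun y => U y - U₁ y)) x c) ∧
    (∀ a b d, Torus.partialDeriv d (Torus.partialDeriv b (Torus.partialDeriv a (fun y => U y c - U₁ y c))) x =
      Torus.partialDeriv d (Torus.partialDeriv b (Torus.partialDeriv a (fun y => U y - U₁ y))) x c) := by
  have hf : (fun y => U y c - U₁ y c) = fun y => (U y - U₁ y) c := by
    funext y; rw [PiLp.sub_apply]
  rw [hf]
  exact ⟨fun a => torusJet_apply_coord_deriv1 h c a x, fun a b => torusJet_apply_coord_deriv2 h c b a x,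
    fun a b d => torusJet_apply_coord_deriv3 h c d b a x⟩

/-- A coordinate is dominated by the Euclidean norm: `(w c)² ≤ ‖w‖²`. [folklore] -/
private theorem l3ir_sq_apply_le (w : V3) (c : Fin 3) : w c ^ 2 ≤ ‖w‖ ^ 2 := by
  have h := PiLp.norm_apply_le w c
  rw [Real.norm_eq_abs] at h
  exact sq_le_sq' (abs_le.1 h).1 (abs_le.1 h).2

/-- From `t² ≤ c b` and `b ≤ E` (`c ≥ 0`): `|t| ≤ √(c E)`. [folklore] -/
private theorem l3ir_rad {t b E c : ℝ} (h1 : t ^ 2 ≤ c * b) (h2 : b ≤ E) (hc : 0 ≤ c) :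
    |t| ≤ Real.sqrt (c * E) :=
  Real.abs_le_sqrt (h1.trans (mul_le_mul_of_nonneg_left h2 hc))

/-- **Pointwise comparison of the sizes of `δV` with the weighted level densities** at a point where the
three weights are `≥ M⁻¹`: `N² ≤ 13122 e₃`, `m₀² ≤ 50 M e₀`, `m₁² ≤ 450 M e₁`, `q² ≤ 4050 M e₂`,
`n² ≤ 36450 M e₃`, `e_k ≥ 0`, and the third-order unweighted energy of each component is `≤ 2 M e₃`. [folklore] -/
theorem level3Rate_sizes_pt :
    ∀ {ζ : ℝ → ℝ} {ρ θ ρ₁ θ₁ : ℝ → T3 → ℝ} {u u₁ : ℝ → T3 → V3} {s Mv : ℝ} {x : T3} {e0 e1 e2 : ℝ},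
    0 < Mv → Torus.IsSmooth (fun y => u s y - u₁ s y) →
    Mv⁻¹ ≤ shadowWeightA ζ ρ θ s x → Mv⁻¹ ≤ ρ s x → Mv⁻¹ ≤ shadowWeightB ρ θ s x →
    e0 = 1 / 2 * (shadowWeightA ζ ρ θ s x * (ρ s x - ρ₁ s x) ^ 2 + ρ s x * ‖u s x - u₁ s x‖ ^ 2 +
      shadowWeightB ρ θ s x * (θ s x - θ₁ s x) ^ 2) →
    e1 = ∑ l : Fin 3, 1 / 2 * (shadowWeightA ζ ρ θ s x * (Torus.partialDeriv l (fun y => ρ s y - ρ₁ s y) x) ^ 2 +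
      ρ s x * ‖Torus.partialDeriv l (fun y => u s y - u₁ s y) x‖ ^ 2 +
      shadowWeightB ρ θ s x * (Torus.partialDeriv l (fun y => θ s y - θ₁ s y) x) ^ 2) →
    e2 = ∑ i : Fin 3, ∑ l : Fin 3, 1 / 2 *
      (shadowWeightA ζ ρ θ s x * (Torus.partialDeriv i (Torus.partialDeriv l (fun y => ρ s y - ρ₁ s y)) x) ^ 2 +
        ρ s x * ‖Torus.partialDeriv i (Torus.partialDeriv l (fun y => u s y - u₁ s y)) x‖ ^ 2 +
        shadowWeightB ρ θ s x * (Torus.partialDeriv i (Torus.partialDeriv l (fun y => θ s y - θ₁ s y)) x) ^ 2) →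
    l3N3 ζ ρ θ ρ₁ θ₁ u u₁ s x ^ 2 ≤ 13122 * l3e3 ζ ρ θ ρ₁ θ₁ u u₁ s x ∧
    l3m0 ρ θ ρ₁ θ₁ u u₁ s x ^ 2 ≤ 50 * Mv * e0 ∧ l3m1 ρ θ ρ₁ θ₁ u u₁ s x ^ 2 ≤ 450 * Mv * e1 ∧
    l3q ρ θ ρ₁ θ₁ u u₁ s x ^ 2 ≤ 4050 * Mv * e2 ∧ l3n ρ θ ρ₁ θ₁ u u₁ s x ^ 2 ≤ 36450 * Mv * l3e3 ζ ρ θ ρ₁ θ₁ u u₁ s x ∧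
    (0 ≤ e0 ∧ 0 ≤ e1 ∧ 0 ≤ e2 ∧ 0 ≤ l3e3 ζ ρ θ ρ₁ θ₁ u u₁ s x) ∧
    (∑ i, ∑ j, ∑ k, Torus.partialDeriv k (Torus.partialDeriv j (Torus.partialDeriv i
        (fun y => ρ s y - ρ₁ s y))) x ^ 2 ≤ 2 * Mv * l3e3 ζ ρ θ ρ₁ θ₁ u u₁ s x) ∧
    (∑ i, ∑ j, ∑ k, Torus.partialDeriv k (Torus.partialDeriv j (Torus.partialDeriv i
        (fun y => θ s y - θ₁ s y))) x ^ 2 ≤ 2 * Mv * l3e3 ζ ρ θ ρ₁ θ₁ u u₁ s x) ∧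
    (∀ c, ∑ i, ∑ j, ∑ k, Torus.partialDeriv k (Torus.partialDeriv j (Torus.partialDeriv i
        (fun y => u s y c - u₁ s y c))) x ^ 2 ≤ 2 * Mv * l3e3 ζ ρ θ ρ₁ θ₁ u u₁ s x) := by
  intro ζ ρ θ ρ₁ θ₁ u u₁ s Mv x e0 e1 e2 hMv hδu hA hP hB hee0 hee1 hee2
  have hA' : Mv⁻¹ ≤ θ s x * (ζ (ρ s x) + ρ s x * deriv ζ (ρ s x)) / ρ s x := hA
  have hB' : Mv⁻¹ ≤ 3 / 2 * ρ s x / θ s x := hB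
  have hw := fun (a nb c : ℝ) (hnb : 0 ≤ nb) => l3ir_term (a := a) (nb := nb) (c := c) hMv hA' hP hB' hnb
  have hw' := fun (a nb c : ℝ) (hnb : 0 ≤ nb) => l3ir_term (a := a) (nb := nb) (c := c) hMv hA hP hB hnb
  have hco := fun c => l3ir_coord hδu c x
  have h2M : 0 ≤ 2 * Mv := by positivity
  -- third-order blocks
  have T3 : ∀ i j k,
      Torus.partialDeriv k (Torus.partialDeriv j (Torus.partialDeriv i (fun y => ρ s y - ρ₁ s y))) x ^ 2 ≤
          2 * Mv * l3e ζ ρ θ ρ₁ θ₁ u u₁ i j k s x ∧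
        ‖Torus.partialDeriv k (Torus.partialDeriv j (Torus.partialDeriv i (fun y => u s y - u₁ s y))) x‖ ^ 2 ≤
          2 * Mv * l3e ζ ρ θ ρ₁ θ₁ u u₁ i j k s x ∧
        Torus.partialDeriv k (Torus.partialDeriv j (Torus.partialDeriv i (fun y => θ s y - θ₁ s y))) x ^ 2 ≤
          2 * Mv * l3e ζ ρ θ ρ₁ θ₁ u u₁ i j k s x ∧
        0 ≤ l3e ζ ρ θ ρ₁ θ₁ u u₁ i j k s x ∧
        l3Nw ζ ρ θ ρ₁ θ₁ u u₁ s x i j k ≤ 3 * Real.sqrt (2 * l3e ζ ρ θ ρ₁ θ₁ u u₁ i j k s x) := by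
    intro i j k
    simp only [l3e, l3Nw]
    exact hw _ _ _ (norm_nonneg _)
  have hE3def : l3e3 ζ ρ θ ρ₁ θ₁ u u₁ s x = ∑ n, ∑ m, ∑ l, l3e ζ ρ θ ρ₁ θ₁ u u₁ l m n s x := rfl
  have hle3 : ∀ i j k, l3e ζ ρ θ ρ₁ θ₁ u u₁ i j k s x ≤ l3e3 ζ ρ θ ρ₁ θ₁ u u₁ s x := fun i j k => by
    rw [hE3def]
    exact l3ir_le_sum3 (g := fun n m l => l3e ζ ρ θ ρ₁ θ₁ u u₁ l m n s x) (fun n m l => (T3 l m n).2.2.2.1) k j i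
  have he3 : 0 ≤ l3e3 ζ ρ θ ρ₁ θ₁ u u₁ s x := (T3 0 0 0).2.2.2.1.trans (hle3 0 0 0)
  have r3ρ := fun i j k => l3ir_rad (T3 i j k).1 (hle3 i j k) h2M
  have r3θ := fun i j k => l3ir_rad (T3 i j k).2.2.1 (hle3 i j k) h2M
  have r3u : ∀ c i j k, |Torus.partialDeriv k (Torus.partialDeriv j (Torus.partialDeriv i
      (fun y => u s y c - u₁ s y c))) x| ≤ Real.sqrt (2 * Mv * l3e3 ζ ρ θ ρ₁ θ₁ u u₁ s x) := by
    intro c i j k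
    rw [(hco c).2.2 i j k]
    exact l3ir_rad ((l3ir_sq_apply_le _ c).trans (T3 i j k).2.1) (hle3 i j k) h2M
  -- `n`
  have hn : l3n ρ θ ρ₁ θ₁ u u₁ s x ^ 2 ≤ 36450 * Mv * l3e3 ζ ρ θ ρ₁ θ₁ u u₁ s x := by
    have h1 : Torus.dsize₃ (fun y => ρ s y - ρ₁ s y) x ≤ 27 * Real.sqrt (2 * Mv * l3e3 ζ ρ θ ρ₁ θ₁ u u₁ s x) :=
      l3ir_sum_le_card.2.2 fun i j k => r3ρ i j k
    have h2 : Torus.dsize₃ (fun y => θ s y - θ₁ s y) x ≤ 27 * Real.sqrt (2 * Mv * l3e3 ζ ρ θ ρ₁ θ₁ u u₁ s x) :=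
      l3ir_sum_le_card.2.2 fun i j k => r3θ i j k
    have h3 : ∑ c : Fin 3, Torus.dsize₃ (fun y => u s y c - u₁ s y c) x ≤
        3 * (27 * Real.sqrt (2 * Mv * l3e3 ζ ρ θ ρ₁ θ₁ u u₁ s x)) :=
      l3ir_sum_le_card.1 fun c => l3ir_sum_le_card.2.2 (r3u c)
    have h4 : l3n ρ θ ρ₁ θ₁ u u₁ s x ≤ 135 * Real.sqrt (2 * Mv * l3e3 ζ ρ θ ρ₁ θ₁ u u₁ s x) := by
      unfold l3n; linarith
    have h0 : 0 ≤ l3n ρ θ ρ₁ θ₁ u u₁ s x := by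
      unfold l3n
      exact add_nonneg (add_nonneg (Torus.dsize₃_nonneg _ _) (Torus.dsize₃_nonneg _ _))
        (Finset.sum_nonneg fun _ _ => Torus.dsize₃_nonneg _ _)
    exact (l3ir_sq_le_of_le_mul_sqrt h0 (by norm_num) (by positivity) h4).trans_eq (by ring)
  -- level 2
  have T2 := fun i l => hw' (Torus.partialDeriv i (Torus.partialDeriv l (fun y => ρ s y - ρ₁ s y)) x)
    ‖Torus.partialDeriv i (Torus.partialDeriv l (fun y => u s y - u₁ s y)) x‖
    (Torus.partialDeriv i (Torus.partialDeriv l (fun y => θ s y - θ₁ s y)) x) (norm_nonneg _)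
  have hle2 := fun i l => (l3ir_le_sum2 (fun i l => (T2 i l).2.2.2.1) i l).trans_eq hee2.symm
  have he2 : 0 ≤ e2 := (T2 0 0).2.2.2.1.trans (hle2 0 0)
  have hq : l3q ρ θ ρ₁ θ₁ u u₁ s x ^ 2 ≤ 4050 * Mv * e2 := by
    have r2ρ : ∀ a b, |Torus.partialDeriv b (Torus.partialDeriv a (fun y => ρ s y - ρ₁ s y)) x| ≤
        Real.sqrt (2 * Mv * e2) := fun a b => l3ir_rad (T2 b a).1 (hle2 b a) h2M
    have r2θ : ∀ a b, |Torus.partialDeriv b (Torus.partialDeriv a (fun y => θ s y - θ₁ s y)) x| ≤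
        Real.sqrt (2 * Mv * e2) := fun a b => l3ir_rad (T2 b a).2.2.1 (hle2 b a) h2M
    have r2u : ∀ c a b, |Torus.partialDeriv b (Torus.partialDeriv a (fun y => u s y c - u₁ s y c)) x| ≤
        Real.sqrt (2 * Mv * e2) := by
      intro c a b
      rw [(hco c).2.1 a b]
      exact l3ir_rad ((l3ir_sq_apply_le _ c).trans (T2 b a).2.1) (hle2 b a) h2M
    have h1 : Torus.dsize₂ (fun y => ρ s y - ρ₁ s y) x ≤ 9 * Real.sqrt (2 * Mv * e2) :=
      l3ir_sum_le_card.2.1 r2ρ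
    have h2 : Torus.dsize₂ (fun y => θ s y - θ₁ s y) x ≤ 9 * Real.sqrt (2 * Mv * e2) :=
      l3ir_sum_le_card.2.1 r2θ
    have h3 : ∑ c : Fin 3, Torus.dsize₂ (fun y => u s y c - u₁ s y c) x ≤
        3 * (9 * Real.sqrt (2 * Mv * e2)) :=
      l3ir_sum_le_card.1 fun c => l3ir_sum_le_card.2.1 (r2u c)
    have h4 : l3q ρ θ ρ₁ θ₁ u u₁ s x ≤ 45 * Real.sqrt (2 * Mv * e2) := by
      unfold l3q; linarith
    have h0 : 0 ≤ l3q ρ θ ρ₁ θ₁ u u₁ s x := by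
      unfold l3q
      exact add_nonneg (add_nonneg (Torus.dsize₂_nonneg _ _) (Torus.dsize₂_nonneg _ _))
        (Finset.sum_nonneg fun _ _ => Torus.dsize₂_nonneg _ _)
    exact (l3ir_sq_le_of_le_mul_sqrt h0 (by norm_num) (by positivity) h4).trans_eq (by ring)
  -- level 1
  have T1 := fun l => hw' (Torus.partialDeriv l (fun y => ρ s y - ρ₁ s y) x)
    ‖Torus.partialDeriv l (fun y => u s y - u₁ s y) x‖ (Torus.partialDeriv l (fun y => θ s y - θ₁ s y) x)
    (norm_nonneg _)
  have hle1 := fun l => (Finset.single_le_sum (fun l _ => (T1 l).2.2.2.1) (Finset.mem_univ l)).trans_eq hee1.symm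
  have he1 : 0 ≤ e1 := (T1 0).2.2.2.1.trans (hle1 0)
  have hm1 : l3m1 ρ θ ρ₁ θ₁ u u₁ s x ^ 2 ≤ 450 * Mv * e1 := by
    have r1ρ : ∀ a, |Torus.partialDeriv a (fun y => ρ s y - ρ₁ s y) x| ≤
        Real.sqrt (2 * Mv * e1) := fun a => l3ir_rad (T1 a).1 (hle1 a) h2M
    have r1θ : ∀ a, |Torus.partialDeriv a (fun y => θ s y - θ₁ s y) x| ≤
        Real.sqrt (2 * Mv * e1) := fun a => l3ir_rad (T1 a).2.2.1 (hle1 a) h2M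
    have r1u : ∀ c a, |Torus.partialDeriv a (fun y => u s y c - u₁ s y c) x| ≤
        Real.sqrt (2 * Mv * e1) := by
      intro c a
      rw [(hco c).1 a]
      exact l3ir_rad ((l3ir_sq_apply_le _ c).trans (T1 a).2.1) (hle1 a) h2M
    have h1 : Torus.dsize₁ (fun y => ρ s y - ρ₁ s y) x ≤ 3 * Real.sqrt (2 * Mv * e1) :=
      l3ir_sum_le_card.1 r1ρ
    have h2 : Torus.dsize₁ (fun y => θ s y - θ₁ s y) x ≤ 3 * Real.sqrt (2 * Mv * e1) :=
      l3ir_sum_le_card.1 r1θ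
    have h3 : ∑ c : Fin 3, Torus.dsize₁ (fun y => u s y c - u₁ s y c) x ≤
        3 * (3 * Real.sqrt (2 * Mv * e1)) :=
      l3ir_sum_le_card.1 fun c => l3ir_sum_le_card.1 (r1u c)
    have h4 : l3m1 ρ θ ρ₁ θ₁ u u₁ s x ≤ 15 * Real.sqrt (2 * Mv * e1) := by
      unfold l3m1; linarith
    exact (l3ir_sq_le_of_le_mul_sqrt (l3m1_N3_nonneg (ζ := ζ)).1 (by norm_num) (by positivity) h4).trans_eq (by ring)
  -- level 0
  have T0 := hw' (ρ s x - ρ₁ s x) ‖u s x - u₁ s x‖ (θ s x - θ₁ s x) (norm_nonneg _)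
  rw [← hee0] at T0
  have he0 : 0 ≤ e0 := T0.2.2.2.1
  have hm0 : l3m0 ρ θ ρ₁ θ₁ u u₁ s x ^ 2 ≤ 50 * Mv * e0 := by
    have r0ρ : |ρ s x - ρ₁ s x| ≤ Real.sqrt (2 * Mv * e0) := Real.abs_le_sqrt T0.1
    have r0θ : |θ s x - θ₁ s x| ≤ Real.sqrt (2 * Mv * e0) :=
      Real.abs_le_sqrt T0.2.2.1
    have r0u : ∀ c, |u s x c - u₁ s x c| ≤ Real.sqrt (2 * Mv * e0) := fun c => by
      rw [← PiLp.sub_apply]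
      exact Real.abs_le_sqrt ((l3ir_sq_apply_le _ c).trans T0.2.1)
    have h3 : ∑ c : Fin 3, |u s x c - u₁ s x c| ≤ 3 * Real.sqrt (2 * Mv * e0) :=
      l3ir_sum_le_card.1 r0u
    have h4 : l3m0 ρ θ ρ₁ θ₁ u u₁ s x ≤ 5 * Real.sqrt (2 * Mv * e0) := by
      unfold l3m0; linarith
    exact (l3ir_sq_le_of_le_mul_sqrt l3m0_nonneg (by norm_num) (by positivity) h4).trans_eq (by ring)
  -- `N`
  have hN : l3N3 ζ ρ θ ρ₁ θ₁ u u₁ s x ^ 2 ≤ 13122 * l3e3 ζ ρ θ ρ₁ θ₁ u u₁ s x := by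
    have h1 : ∀ n m l, l3Nw ζ ρ θ ρ₁ θ₁ u u₁ s x l m n ≤ 3 * Real.sqrt (2 * l3e3 ζ ρ θ ρ₁ θ₁ u u₁ s x) :=
      fun n m l => (T3 l m n).2.2.2.2.trans (mul_le_mul_of_nonneg_left
        (Real.sqrt_le_sqrt (by linarith [hle3 l m n])) (by norm_num))
    have h2 : l3N3 ζ ρ θ ρ₁ θ₁ u u₁ s x ≤ 81 * Real.sqrt (2 * l3e3 ζ ρ θ ρ₁ θ₁ u u₁ s x) := by
      have := l3ir_sum_le_card.2.2 h1
      unfold l3N3; linarith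
    exact (l3ir_sq_le_of_le_mul_sqrt (l3m1_N3_nonneg (ζ := ζ)).2 (by norm_num) (by positivity) h2).trans_eq (by ring)
  -- third-order unweighted energies
  have hsum3 : ∑ i, ∑ j, ∑ k, l3e ζ ρ θ ρ₁ θ₁ u u₁ i j k s x = l3e3 ζ ρ θ ρ₁ θ₁ u u₁ s x := by
    rw [hE3def]
    exact l3ir_sum3_rev (fun k j i => l3e ζ ρ θ ρ₁ θ₁ u u₁ i j k s x)
  have P7ρ : ∑ i, ∑ j, ∑ k, Torus.partialDeriv k (Torus.partialDeriv j (Torus.partialDeriv i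
      (fun y => ρ s y - ρ₁ s y))) x ^ 2 ≤ 2 * Mv * l3e3 ζ ρ θ ρ₁ θ₁ u u₁ s x := by
    calc _ ≤ ∑ i, ∑ j, ∑ k, 2 * Mv * l3e ζ ρ θ ρ₁ θ₁ u u₁ i j k s x :=
          Finset.sum_le_sum fun i _ => Finset.sum_le_sum fun j _ => Finset.sum_le_sum fun k _ => (T3 i j k).1
      _ = _ := by simp only [← Finset.mul_sum]; rw [hsum3]
  have P7θ : ∑ i, ∑ j, ∑ k, Torus.partialDeriv k (Torus.partialDeriv j (Torus.partialDeriv i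
      (fun y => θ s y - θ₁ s y))) x ^ 2 ≤ 2 * Mv * l3e3 ζ ρ θ ρ₁ θ₁ u u₁ s x := by
    calc _ ≤ ∑ i, ∑ j, ∑ k, 2 * Mv * l3e ζ ρ θ ρ₁ θ₁ u u₁ i j k s x :=
          Finset.sum_le_sum fun i _ => Finset.sum_le_sum fun j _ => Finset.sum_le_sum fun k _ =>
            (T3 i j k).2.2.1
      _ = _ := by simp only [← Finset.mul_sum]; rw [hsum3]
  have P7u : ∀ c, ∑ i, ∑ j, ∑ k, Torus.partialDeriv k (Torus.partialDeriv j (Torus.partialDeriv i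
      (fun y => u s y c - u₁ s y c))) x ^ 2 ≤ 2 * Mv * l3e3 ζ ρ θ ρ₁ θ₁ u u₁ s x := by
    intro c
    calc _ ≤ ∑ i, ∑ j, ∑ k, 2 * Mv * l3e ζ ρ θ ρ₁ θ₁ u u₁ i j k s x := by
          refine Finset.sum_le_sum fun i _ => Finset.sum_le_sum fun j _ => Finset.sum_le_sum fun k _ => ?_
          rw [(hco c).2.2 i j k]
          exact (l3ir_sq_apply_le _ c).trans (T3 i j k).2.1
      _ = _ := by simp only [← Finset.mul_sum]; rw [hsum3]
  exact ⟨hN, hm0, hm1, hq, hn, ⟨he0, he1, he2, he3⟩, P7ρ, P7θ, P7u⟩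

/-- The jets of `δV` at `x` are bounded by the pointwise magnitudes `l3m0`, `l3m1`, `l3q`. [folklore] -/
theorem level3Rate_jets :
    ∀ {ρ θ ρ₁ θ₁ : ℝ → T3 → ℝ} {u u₁ : ℝ → T3 → V3} (t : ℝ) (x : T3),
    Level3Jets ρ θ ρ₁ θ₁ u u₁ t x (l3m0 ρ θ ρ₁ θ₁ u u₁ t x) (l3m1 ρ θ ρ₁ θ₁ u u₁ t x) (l3q ρ θ ρ₁ θ₁ u u₁ t x) := by
  intro ρ θ ρ₁ θ₁ u u₁ t x
  have s0 : ∀ i, |u t x i - u₁ t x i| ≤ ∑ i, |u t x i - u₁ t x i| := fun i =>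
    Finset.single_le_sum (f := fun i => |u t x i - u₁ t x i|) (fun _ _ => abs_nonneg _) (Finset.mem_univ i)
  have s1 : ∀ i, Torus.dsize₁ (fun y => u t y i - u₁ t y i) x ≤ ∑ i, Torus.dsize₁ (fun y => u t y i - u₁ t y i) x :=
    fun i => Finset.single_le_sum (f := fun i => Torus.dsize₁ (fun y => u t y i - u₁ t y i) x)
      (fun _ _ => Torus.dsize₁_nonneg _ _) (Finset.mem_univ i)
  have s2 : ∀ i, Torus.dsize₂ (fun y => u t y i - u₁ t y i) x ≤ ∑ i, Torus.dsize₂ (fun y => u t y i - u₁ t y i) x :=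
    fun i => Finset.single_le_sum (f := fun i => Torus.dsize₂ (fun y => u t y i - u₁ t y i) x)
      (fun _ _ => Torus.dsize₂_nonneg _ _) (Finset.mem_univ i)
  have n0 := fun i => abs_nonneg (u t x i - u₁ t x i)
  have a0 := abs_nonneg (ρ t x - ρ₁ t x)
  have b0 := abs_nonneg (θ t x - θ₁ t x)
  have d1ρ := Torus.dsize₁_nonneg (fun y => ρ t y - ρ₁ t y) x
  have d1θ := Torus.dsize₁_nonneg (fun y => θ t y - θ₁ t y) x
  have d1u := fun i => Torus.dsize₁_nonneg (fun y => u t y i - u₁ t y i) x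
  have d2ρ := Torus.dsize₂_nonneg (fun y => ρ t y - ρ₁ t y) x
  have d2θ := Torus.dsize₂_nonneg (fun y => θ t y - θ₁ t y) x
  have d2u := fun i => Torus.dsize₂_nonneg (fun y => u t y i - u₁ t y i) x
  have hs0 : 0 ≤ ∑ i, |u t x i - u₁ t x i| := Finset.sum_nonneg fun i _ => n0 i
  have hs1 : 0 ≤ ∑ i, Torus.dsize₁ (fun y => u t y i - u₁ t y i) x := Finset.sum_nonneg fun i _ => d1u i
  have hs2 : 0 ≤ ∑ i, Torus.dsize₂ (fun y => u t y i - u₁ t y i) x := Finset.sum_nonneg fun i _ => d2u i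
  unfold Level3Jets l3m0 l3m1 l3q
  refine ⟨by linarith, by linarith, fun i => by linarith [s0 i], fun a => ?_, fun a => ?_, fun i a => ?_,
    fun a b => ?_, fun a b => ?_, fun i a b => ?_⟩
  · linarith [Torus.abs_partialDeriv_le_dsize₁ (fun y => ρ t y - ρ₁ t y) x a]
  · linarith [Torus.abs_partialDeriv_le_dsize₁ (fun y => θ t y - θ₁ t y) x a]
  · linarith [Torus.abs_partialDeriv_le_dsize₁ (fun y => u t y i - u₁ t y i) x a, s1 i]
  · linarith [Torus.abs_partialDeriv₂_le_dsize₂ (fun y => ρ t y - ρ₁ t y) x a b]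
  · linarith [Torus.abs_partialDeriv₂_le_dsize₂ (fun y => θ t y - θ₁ t y) x a b]
  · linarith [Torus.abs_partialDeriv₂_le_dsize₂ (fun y => u t y i - u₁ t y i) x a b, s2 i]

/-- Nonnegativity bookkeeping of the envelope: `1 ≤ R₀ ≤ l3base` and `1 ≤ l3base`. [folklore] -/
theorem level3Rate_base {K cl pl T₁ t : ℝ} {Cpoly ppoly : ℕ → ℝ} (hK : 0 < K) (hcl : 0 < cl)
    (hC : ∀ n, 0 ≤ Cpoly n) (ht : t < T₁) {R₀ B : ℝ}
    (hR : R₀ = 576 * (1 + K) * (1 + ∑ n ∈ Finset.range 7, Cpoly n * (T₁ - t) ^ (-ppoly n)) ^ 5 *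
      (1 + (cl * (T₁ - t) ^ pl)⁻¹) ^ 5) (hB : B = l3base K cl pl T₁ Cpoly ppoly t) :
    1 ≤ R₀ ∧ R₀ ≤ B ∧ B = (1 + K + K⁻¹) * R₀ * (1 + (T₁ - t)⁻¹) := by
  have hlam : 0 < T₁ - t := sub_pos.2 ht
  have hS : 0 ≤ ∑ n ∈ Finset.range 7, Cpoly n * (T₁ - t) ^ (-ppoly n) :=
    Finset.sum_nonneg fun n _ => mul_nonneg (hC n) (Real.rpow_nonneg hlam.le _)
  have hF : 0 ≤ (cl * (T₁ - t) ^ pl)⁻¹ := inv_nonneg.2 (mul_nonneg hcl.le (Real.rpow_nonneg hlam.le _))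
  generalize hSdef : ∑ n ∈ Finset.range 7, Cpoly n * (T₁ - t) ^ (-ppoly n) = Sg at hS hR
  generalize hFdef : (cl * (T₁ - t) ^ pl)⁻¹ = Fg at hF hR
  have hB' : B = (1 + K + K⁻¹) * R₀ * (1 + (T₁ - t)⁻¹) := by
    rw [hB, hR]; unfold l3base; rw [hSdef, hFdef]
  have h1 : 1 ≤ (1 + Sg) ^ 5 := one_le_pow₀ (by linarith)
  have h2 : 1 ≤ (1 + Fg) ^ 5 := one_le_pow₀ (by linarith)
  have hR1 : 1 ≤ R₀ := by
    rw [hR]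
    have h3 : (1 : ℝ) ≤ 576 * (1 + K) := by nlinarith
    calc (1 : ℝ) = 1 * 1 * 1 := by ring
      _ ≤ 576 * (1 + K) * (1 + Sg) ^ 5 * (1 + Fg) ^ 5 :=
        mul_le_mul (mul_le_mul h3 h1 zero_le_one (by positivity)) h2 zero_le_one (by positivity)
  have hKi : 0 ≤ K⁻¹ := inv_nonneg.2 hK.le
  have hli : 0 ≤ (T₁ - t)⁻¹ := inv_nonneg.2 hlam.le
  refine ⟨hR1, ?_, hB'⟩
  rw [hB']
  have hR0 : 0 ≤ R₀ := by linarith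
  calc R₀ = 1 * R₀ * 1 := by ring
    _ ≤ (1 + K + K⁻¹) * R₀ * (1 + (T₁ - t)⁻¹) :=
      mul_le_mul (mul_le_mul_of_nonneg_right (by linarith) hR0) (by linarith) zero_le_one (by positivity)

end Summit.AtomisticToContinuum.HydrodynamicLimit.Theorems

end
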